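import Literature.Algebra.Homology.CechTupleFaces
import Mathlib.Algebra.BigOperators.Group.Finset.Basic
import Mathlib.Algebra.BigOperators.GroupWithZero.Action
import Mathlib.Algebra.Module.Basic
import HarnessLib

/-!
# The `∂∂̄` zig-zag in the Čech complex of a stratified system ("principle of two types")

P. Deligne, P. Griffiths, J. Morgan, D. Sullivan, *Real homotopy theory of Kähler manifolds*,
Invent. Math. 29 (1975), §5 (the `dd^c`-lemma 5.11 and its consequences) and P. Griffiths,
W. Schmid, *Recent developments in Hodge theory* (1975), §4 (varieties with normal crossings: the
weight spectral sequence of `D = ⋃ D_i` degenerates by "the principle of two types"); the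
statement served is P. Deligne, *Théorie de Hodge III* (1974), Prop. 8.2.7 / the tree's named fact
`HodgeTheory.Deligne1974_ker_pullback_eq_ker_pullback_resolution`, along the Hodge-decomposition
route recorded in that unit's notes.

This file isolates the ALGEBRA of that argument. The geometric situation is a compact Kähler
manifold `M` with closed complex submanifolds `F_1, …, F_N` all of whose intersections
`F_J = F_{j₀} ∩ ⋯ ∩ F_{j_s}` are compact Kähler (the strata of a simple normal crossing
configuration), the complex differential forms `T_J = A^•(F_J)` with `d`, the projections
`π_{i,k}` onto the forms of type `(i, k)`, and the restriction maps along `F_J ⊆ F_{J ∘ θ}`; on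
every stratum the `∂∂̄`-lemma holds. Abstractly (`DDbarCechSystem`): additive groups `T J`
indexed by all tuples `J : Fin p → ι` (the empty tuple is the ambient space), additive maps
`res J θ : T (J ∘ θ) → T J` for every `θ : Fin p → Fin q` (functorial), `d : T J → T J` with
`d ∘ d = 0`, commuting idempotent "type projections" `π i k` with `π i k ∘ π i' k' = 0` for
`(i, k) ≠ (i', k')`, such that a pure element `x = π i k x` has `d x = π (i+1) k (d x) + π i (k+1) (d x)`
(`d = ∂ + ∂̄`), everything compatible with `res`. Write `∂ x = π (i+1) k (d x)` and
`∂̄ x = π i (k+1) (d x)` for `x` pure of type `(i, k)`, and let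
`(δ y)_K = Σ_j (-1)^j res_{σ_j} y_{K ∘ σ_j}` be the differential of the full ordered Čech complex
(`cechδ`; `δ ∘ δ = 0`, `cechδ_cechδ`, from `CechTuple.sum_sum_neg_one_pow_smul_smul_faces_eq_zero`).

**The zig-zag** (`DDbarCechSystem.exists_zigzag`). Suppose the `∂∂̄`-lemma in the form "a
`d`-closed, `∂̄`-exact element of pure type `(i, k+1)` is `∂∂̄g` for some `g` of type `(i-1, k)`,
and is `0` if `i = 0`" holds on every stratum of length `≥ 2`, and let `x_J ∈ T_J` (`J` of length
`1` and `2`, compatible with restriction) be of the form `x_J = ∂∂̄ g_J` with `g_J` pure of type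
`(a', b')` on the strata of length `1` (in the application: `x_J = ω|_{F_j}` for a closed form `ω` of
pure type `(a'+1, b'+1)` on `M` whose restriction to each `F_j` is exact — by the `∂∂̄`-lemma on
`F_j`). THEN there are Čech cochains `η_s ∈ Π_{|J| = s+1} T_J` (`s ≥ 0`) with

  `d η_0 = x`, `δ η_s = d η_{s+1}` for all `s`, `η_s = 0` for `s > a'`,

`η_s` pure of type `(a' - s, b' + 1)`: namely `η_s = ∂̄ h_s` where `h_0 = g` and, inductively,
`δ η_s = ∂̄ (δ h_s)` is `d`-closed (`∂ δ η_s = δ ∂∂̄ h_s = ± δ δ η_{s-1} = 0`) and `∂̄`-exact of pure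
type `(a' - s, b' + 1)`, hence `= ∂∂̄ h_{s+1}` by the `∂∂̄`-lemma on the strata of length `s + 2`;
the process stops when the first type index reaches `0`. In the total complex of the Čech–de Rham
double complex this says that the restriction cocycle `(ω|_{F_j})_j` is a coboundary — the
cochain-level content of "`Ker(Hⁿ(M) → ⊕ Hⁿ(F_j)) → Hⁿ(⋃ F_j)` vanishes" (Deligne's 8.2.7 for the
union of the `F_j`), to be combined with the (topological) Mayer–Vietoris gluing on neighbourhoods.

Everything here is elementary additive algebra; no topology. Definitions: the structure
`DDbarCechSystem`, `cechδ`, and the (private) recursion `DDbarCechSystem.stage`. No named facts.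

## References

* [DeligneGriffithsMorganSullivan1975] P. Deligne, P. Griffiths, J. Morgan, D. Sullivan, Real
  homotopy theory of Kähler manifolds, Invent. Math. 29 (1975), §5, Lemma 5.11; §6.
* P. Griffiths, W. Schmid, Recent developments in Hodge theory, in: Discrete
  subgroups of Lie groups (Bombay 1973), OUP 1975, §4.
* [DeligneHodgeIII1974] P. Deligne, Théorie de Hodge III, Publ. Math. IHÉS 44 (1974), Prop. 8.2.7.
* [BottTu1982Forms] R. Bott, L. W. Tu, Differential Forms in Algebraic Topology (1982), §8 (8.4).
-/

noncomputable section

open Finset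

namespace Literature.Algebra.Homology

universe u v

/-! ### The abstract system -/

/-- **A `∂∂̄`-Čech system** over an index type `ι`: for every tuple `J : Fin p → ι` (`p ≥ 0`; the
empty tuple is the ambient space, `J` of length `s + 1` the stratum `F_{J 0} ∩ ⋯ ∩ F_{J s}`) an
additive group `T J` ("all complex differential forms on the stratum"), restriction maps
`res J θ : T (J ∘ θ) →+ T J` along every re-indexing `θ : Fin p → Fin q` (the stratum of `J` lies
in that of `J ∘ θ`), functorial in `θ`; a differential `d` with `d ∘ d = 0`; and commuting
idempotent, pairwise orthogonal type projections `π i k` such that on an element of pure type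
`(i, k)` the differential has only the components of types `(i+1, k)` and `(i, k+1)` — all
compatible with restriction (DGMS 1975 §5: the real/complex de Rham algebra of a compact Kähler
manifold with `d = ∂ + ∂̄`; here without products and without gradings, the degree being carried
by the types). [cite: DeligneGriffithsMorganSullivan1975, §5] -/
structure DDbarCechSystem (ι : Type u) where
  /-- the forms on the stratum indexed by the tuple `J` -/
  T : ∀ ⦃p : ℕ⦄, (Fin p → ι) → Type v
  /-- they form additive groups -/
  [addCommGroup : ∀ ⦃p : ℕ⦄ (J : Fin p → ι), AddCommGroup (T J)]
  /-- restriction along `F_J ⊆ F_{J ∘ θ}` -/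
  res : ∀ ⦃p q : ℕ⦄ (J : Fin q → ι) (θ : Fin p → Fin q), T (J ∘ θ) →+ T J
  /-- the exterior differential -/
  d : ∀ ⦃p : ℕ⦄ (J : Fin p → ι), T J →+ T J
  /-- the projection onto the forms of type `(i, k)` -/
  π : ∀ ⦃p : ℕ⦄ (J : Fin p → ι) (i k : ℕ), T J →+ T J
  /-- restriction is functorial -/
  res_res : ∀ ⦃p q m : ℕ⦄ (J : Fin q → ι) (θ : Fin p → Fin q) (θ' : Fin m → Fin p)
    (z : T (J ∘ θ ∘ θ')), res J θ (res (J ∘ θ) θ' z) = res J (θ ∘ θ') z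
  /-- restriction commutes with `d` -/
  res_d : ∀ ⦃p q : ℕ⦄ (J : Fin q → ι) (θ : Fin p → Fin q) (z : T (J ∘ θ)),
    res J θ (d (J ∘ θ) z) = d J (res J θ z)
  /-- restriction preserves types -/
  res_π : ∀ ⦃p q : ℕ⦄ (J : Fin q → ι) (θ : Fin p → Fin q) (i k : ℕ) (z : T (J ∘ θ)),
    res J θ (π (J ∘ θ) i k z) = π J i k (res J θ z)
  /-- `d ∘ d = 0` -/
  d_d : ∀ ⦃p : ℕ⦄ (J : Fin p → ι) (z : T J), d J (d J z) = 0
  /-- the type projections are idempotent … -/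
  π_π : ∀ ⦃p : ℕ⦄ (J : Fin p → ι) (i k : ℕ) (z : T J), π J i k (π J i k z) = π J i k z
  /-- … and pairwise orthogonal -/
  π_π_of_ne : ∀ ⦃p : ℕ⦄ (J : Fin p → ι) (i k i' k' : ℕ), (i, k) ≠ (i', k') →
    ∀ z : T J, π J i k (π J i' k' z) = 0
  /-- `d = ∂ + ∂̄` on pure elements: `d` of an element of type `(i, k)` has only the components of
  types `(i+1, k)` and `(i, k+1)` (integrability of the complex structure). -/
  d_of_pure : ∀ ⦃p : ℕ⦄ (J : Fin p → ι) (i k : ℕ) (z : T J), π J i k z = z →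
    d J z = π J (i + 1) k (d J z) + π J i (k + 1) (d J z)

namespace DDbarCechSystem

attribute [instance] DDbarCechSystem.addCommGroup

variable {ι : Type u} (S : DDbarCechSystem.{u, v} ι)

/-! ### `∂` and `∂̄` on pure elements -/

/-- `∂̄ ∘ ∂̄ = 0` on an element of pure type `(i, k)` (from `d ∘ d = 0` and the type behaviour of
`d`). [cite: DeligneGriffithsMorganSullivan1975, §5] -/
theorem dbar_dbar {p : ℕ} (J : Fin p → ι) (i k : ℕ) (z : S.T J) (hz : S.π J i k z = z) :
    S.π J i (k + 2) (S.d J (S.π J i (k + 1) (S.d J z))) = 0 := by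
  -- `d z = ∂ z + ∂̄ z`, `0 = d d z = d ∂ z + d ∂̄ z`; project onto type `(i, k+2)`
  have h1 : S.d J z = S.π J (i + 1) k (S.d J z) + S.π J i (k + 1) (S.d J z) := S.d_of_pure J i k z hz
  have hA : S.π J (i + 1) k (S.π J (i + 1) k (S.d J z)) = S.π J (i + 1) k (S.d J z) := S.π_π J _ _ _
  have hB : S.π J i (k + 1) (S.π J i (k + 1) (S.d J z)) = S.π J i (k + 1) (S.d J z) := S.π_π J _ _ _
  have h2 := S.d_of_pure J (i + 1) k _ hA
  have h3 := S.d_of_pure J i (k + 1) _ hB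
  have h0 : S.d J (S.d J z) = 0 := S.d_d J z
  rw [h1, map_add, h2, h3] at h0
  have h4 := congrArg (S.π J i (k + 2)) h0
  rw [map_zero, map_add, map_add, map_add, S.π_π_of_ne J i (k + 2) (i + 1 + 1) k (by simp),
    S.π_π_of_ne J i (k + 2) (i + 1) (k + 1) (by simp), S.π_π_of_ne J i (k + 2) (i + 1) (k + 1) (by simp),
    S.π_π, zero_add, zero_add, zero_add] at h4
  exact h4

/-- `d ∂̄ z = ∂ ∂̄ z` on an element of pure type `(i, k)` (as `∂̄ ∂̄ z = 0`). [cite: DeligneGriffithsMorganSullivan1975, §5] -/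
theorem d_dbar {p : ℕ} (J : Fin p → ι) (i k : ℕ) (z : S.T J) (hz : S.π J i k z = z) :
    S.d J (S.π J i (k + 1) (S.d J z)) =
      S.π J (i + 1) (k + 1) (S.d J (S.π J i (k + 1) (S.d J z))) := by
  have hB : S.π J i (k + 1) (S.π J i (k + 1) (S.d J z)) = S.π J i (k + 1) (S.d J z) := S.π_π J _ _ _
  have h := S.d_of_pure J i (k + 1) _ hB
  rw [S.dbar_dbar J i k z hz, add_zero] at h
  exact h

/-- `∂ ∂̄ g` is `d`-closed: indeed `∂ ∂̄ g = d ∂̄ g`. [cite: DeligneGriffithsMorganSullivan1975, §5] -/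
theorem d_del_dbar {p : ℕ} (J : Fin p → ι) (i k : ℕ) (z : S.T J) (hz : S.π J i k z = z) :
    S.d J (S.π J (i + 1) (k + 1) (S.d J (S.π J i (k + 1) (S.d J z)))) = 0 := by
  rw [← S.d_dbar J i k z hz, S.d_d]

/-! ### Čech cochains and the Čech differential -/

/-- **The Čech differential** of the full ordered Čech complex with values in the system:
`(δ y)_K = Σ_{j} (-1)^j res_{σ_j} (y_{K ∘ σ_j})`, `σ_j = Fin.succAbove j` omitting the `j`-th entry
(Bott–Tu (1982), (8.4)). [cite: BottTu1982Forms, §8 (8.4)] -/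
def cechδ {s : ℕ} (y : ∀ J : Fin (s + 1) → ι, S.T J) (K : Fin (s + 2) → ι) : S.T K :=
  ∑ j : Fin (s + 2), ((-1 : ℤ) ^ (j : ℕ)) • S.res K (Fin.succAbove j) (y (K ∘ Fin.succAbove j))

/-- `δ 0 = 0`. [folklore] -/
@[simp] theorem cechδ_zero {s : ℕ} (K : Fin (s + 2) → ι) :
    S.cechδ (fun J : Fin (s + 1) → ι ↦ (0 : S.T J)) K = 0 := by
  simp [cechδ]

/-- **`δ ∘ δ = 0`** (the double faces cancel in pairs, `CechTuple.sum_sum_neg_one_pow_smul_smul_faces_eq_zero`,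
with the functoriality of restriction). [cite: BottTu1982Forms, §8 (8.4)] -/
theorem cechδ_cechδ {s : ℕ} (y : ∀ J : Fin (s + 1) → ι, S.T J) (K : Fin (s + 3) → ι) :
    S.cechδ (S.cechδ y) K = 0 := by
  have h := CechTuple.sum_sum_neg_one_pow_smul_smul_faces_eq_zero (R := ℤ)
    (fun θ : Fin (s + 1) → Fin (s + 3) ↦ S.res K θ (y (K ∘ θ)))
  simp only [cechδ, map_sum, map_zsmul, Finset.smul_sum, S.res_res] at h ⊢
  exact h

/-- `δ` commutes with every family of additive operators compatible with restriction (applied to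
`d`, `π i k` and their composites). [folklore] -/
theorem cechδ_map {s : ℕ} (φ : ∀ ⦃p : ℕ⦄ (J : Fin p → ι), S.T J →+ S.T J)
    (hφ : ∀ ⦃p q : ℕ⦄ (J : Fin q → ι) (θ : Fin p → Fin q) (z : S.T (J ∘ θ)),
      S.res J θ (φ (J ∘ θ) z) = φ J (S.res J θ z))
    (y : ∀ J : Fin (s + 1) → ι, S.T J) (K : Fin (s + 2) → ι) :
    S.cechδ (fun J ↦ φ J (y J)) K = φ K (S.cechδ y K) := by
  simp only [cechδ, map_sum, map_zsmul, hφ]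

/-- `δ` commutes with `d`. [folklore] -/
theorem cechδ_d {s : ℕ} (y : ∀ J : Fin (s + 1) → ι, S.T J) (K : Fin (s + 2) → ι) :
    S.cechδ (fun J ↦ S.d J (y J)) K = S.d K (S.cechδ y K) :=
  S.cechδ_map (fun _ J ↦ S.d J) (fun _ _ J θ z ↦ S.res_d J θ z) y K

/-- `δ` commutes with the type projections. [folklore] -/
theorem cechδ_π {s : ℕ} (i k : ℕ) (y : ∀ J : Fin (s + 1) → ι, S.T J) (K : Fin (s + 2) → ι) :
    S.cechδ (fun J ↦ S.π J i k (y J)) K = S.π K i k (S.cechδ y K) :=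
  S.cechδ_map (fun _ J ↦ S.π J i k) (fun _ _ J θ z ↦ S.res_π J θ i k z) y K

/-- `δ` preserves purity of type. [folklore] -/
theorem π_cechδ_of_pure {s : ℕ} (i k : ℕ) (y : ∀ J : Fin (s + 1) → ι, S.T J)
    (hy : ∀ J, S.π J i k (y J) = y J) (K : Fin (s + 2) → ι) :
    S.π K i k (S.cechδ y K) = S.cechδ y K := by
  rw [← S.cechδ_π]
  congr 1
  funext J
  exact hy J

/-- A `1`-cochain obtained by restricting ONE element to all strata of length `1` and `2`
compatibly (`res_{σ_j} x_{K ∘ σ_j} = x_K`) is a `δ`-cocycle: `(δ x)_K = x_K - x_K = 0`. [folklore] -/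
theorem cechδ_eq_zero_of_res_eq (x : ∀ ⦃p : ℕ⦄ (J : Fin p → ι), S.T J)
    (hx : ∀ (K : Fin 2 → ι) (j : Fin 2), S.res K (Fin.succAbove j) (x (K ∘ Fin.succAbove j)) = x K)
    (K : Fin 2 → ι) : S.cechδ (fun J : Fin 1 → ι ↦ x J) K = 0 := by
  show (∑ j : Fin 2, ((-1 : ℤ) ^ (j : ℕ)) • S.res K (Fin.succAbove j) (x (K ∘ Fin.succAbove j))) = 0
  rw [Fin.sum_univ_two, hx, hx]
  simp

/-! ### The recursion -/

section Zigzag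

variable {S}
variable {b' : ℕ}

/- The two hypothesis shapes of `exists_zigzag` — the `∂∂̄`-lemma on the strata of length `≥ 2`
(Huybrechts (2005), Cor. 3.2.10: on a compact Kähler manifold a `d`-closed `(p, q)`-form which is
`∂̄`-exact is `∂∂̄`-exact), for `d`-closed `∂̄`-exact elements `∂̄ v` with `v` pure of type `(i, b')`:
for `i = 0` such an element vanishes (`DDbarZeroHyp`), for `i = i₀ + 1` it is `∂∂̄ g` with `g` pure
of type `(i₀, b')` (`DDbarSuccHyp`). They are notations (the hypotheses are spelled out in every
statement), not definitions. -/
set_option quotPrecheck false in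
local notation "DDbarZeroHyp" =>
  ∀ (s : ℕ) (K : Fin (s + 2) → ι) (v : DDbarCechSystem.T S K), S.π K 0 b' v = v →
    S.d K (S.π K 0 (b' + 1) (S.d K v)) = 0 → S.π K 0 (b' + 1) (S.d K v) = 0

set_option quotPrecheck false in
local notation "DDbarSuccHyp" =>
  ∀ (s : ℕ) (K : Fin (s + 2) → ι) (i₀ : ℕ) (v : DDbarCechSystem.T S K), S.π K (i₀ + 1) b' v = v →
    S.d K (S.π K (i₀ + 1) (b' + 1) (S.d K v)) = 0 →
      ∃ g : S.T K, S.π K i₀ b' g = g ∧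
        S.π K (i₀ + 1) (b' + 1) (S.d K v) =
          S.π K (i₀ + 1) (b' + 1) (S.d K (S.π K i₀ (b' + 1) (S.d K g)))

/-- A stage of the zig-zag: a first type index `i`, a Čech `s`-cochain `h` of pure type `(i, b')`
(the `∂∂̄`-potential), such that `δ (∂∂̄ h) = 0`. [cite: DeligneGriffithsMorganSullivan1975, §5] -/
private structure Stage (s : ℕ) where
  i : ℕ
  h : ∀ J : Fin (s + 1) → ι, S.T J
  pure : ∀ J, S.π J i b' (h J) = h J
  inv : ∀ K : Fin (s + 2) → ι,
    S.cechδ (fun J ↦ S.π J (i + 1) (b' + 1) (S.d J (S.π J i (b' + 1) (S.d J (h J))))) K = 0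

/-- `∂∂̄ h` commutes with `δ`. [folklore] -/
private theorem cechδ_del_dbar {s : ℕ} (i : ℕ) (y : ∀ J : Fin (s + 1) → ι, S.T J)
    (K : Fin (s + 2) → ι) :
    S.cechδ (fun J ↦ S.π J (i + 1) (b' + 1) (S.d J (S.π J i (b' + 1) (S.d J (y J))))) K =
      S.π K (i + 1) (b' + 1) (S.d K (S.π K i (b' + 1) (S.d K (S.cechδ y K)))) := by
  rw [S.cechδ_π, S.cechδ_d, S.cechδ_π, S.cechδ_d]

/-- `∂̄ h` commutes with `δ`. [folklore] -/
private theorem cechδ_dbar {s : ℕ} (i : ℕ) (y : ∀ J : Fin (s + 1) → ι, S.T J)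
    (K : Fin (s + 2) → ι) :
    S.cechδ (fun J ↦ S.π J i (b' + 1) (S.d J (y J))) K = S.π K i (b' + 1) (S.d K (S.cechδ y K)) := by
  rw [S.cechδ_π, S.cechδ_d]

/-- `δ h_s` is pure of type `(i, b')`. [folklore] -/
private theorem Stage.pure_cechδ {s : ℕ} (st : Stage (S := S) (b' := b') s)
    (K : Fin (s + 2) → ι) : S.π K st.i b' (S.cechδ st.h K) = S.cechδ st.h K :=
  S.π_cechδ_of_pure _ _ st.h st.pure K

/-- `∂̄ (δ h_s)` is `d`-closed: its `∂̄` vanishes and its `∂` is `δ (∂∂̄ h_s) = 0` by the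
invariant. [cite: DeligneGriffithsMorganSullivan1975, §5] -/
private theorem Stage.d_dbar_cechδ {s : ℕ} (st : Stage (S := S) (b' := b') s)
    (K : Fin (s + 2) → ι) : S.d K (S.π K st.i (b' + 1) (S.d K (S.cechδ st.h K))) = 0 := by
  rw [S.d_of_pure K st.i (b' + 1) _ (S.π_π K _ _ _), S.dbar_dbar K st.i b' _ (st.pure_cechδ K),
    add_zero, ← cechδ_del_dbar, st.inv K]

/-- `δ h_s` is pure of type `(i₁ + 1, b')` when `i = i₁ + 1` (re-indexed `Stage.pure_cechδ`). [folklore] -/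
private theorem Stage.pure_cechδ' {s : ℕ} (st : Stage (S := S) (b' := b') s) {i₁ : ℕ}
    (e : st.i = i₁ + 1) (K : Fin (s + 2) → ι) :
    S.π K (i₁ + 1) b' (S.cechδ st.h K) = S.cechδ st.h K := by
  have h := st.pure_cechδ K
  rw [e] at h
  exact h

/-- `∂̄ (δ h_s)` is `d`-closed, re-indexed form of `Stage.d_dbar_cechδ` for `i = i₁ + 1`. [folklore] -/
private theorem Stage.d_dbar_cechδ' {s : ℕ} (st : Stage (S := S) (b' := b') s) {i₁ : ℕ}
    (e : st.i = i₁ + 1) (K : Fin (s + 2) → ι) :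
    S.d K (S.π K (i₁ + 1) (b' + 1) (S.d K (S.cechδ st.h K))) = 0 := by
  have h := st.d_dbar_cechδ K
  rw [e] at h
  exact h

/-- The invariant propagates: `δ (∂∂̄ h_{s+1}) = δ (∂̄ δ h_s) = ∂̄ (δ δ h_s) = 0`. [cite: DeligneGriffithsMorganSullivan1975, §5] -/
private theorem step_inv (h1 : DDbarSuccHyp) {s : ℕ} (st : Stage (S := S) (b' := b') s)
    {i₁ : ℕ} (e : st.i = i₁ + 1) (L : Fin (s + 1 + 2) → ι) :
    S.cechδ (fun K : Fin (s + 1 + 1) → ι ↦ S.π K (i₁ + 1) (b' + 1) (S.d K (S.π K i₁ (b' + 1)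
      (S.d K (h1 s K i₁ (S.cechδ st.h K) (st.pure_cechδ' e K) (st.d_dbar_cechδ' e K)).choose)))) L
      = 0 := by
  have heq : (fun K : Fin (s + 1 + 1) → ι ↦ S.π K (i₁ + 1) (b' + 1) (S.d K (S.π K i₁ (b' + 1)
      (S.d K (h1 s K i₁ (S.cechδ st.h K) (st.pure_cechδ' e K) (st.d_dbar_cechδ' e K)).choose)))) =
      fun K ↦ S.π K (i₁ + 1) (b' + 1) (S.d K (S.cechδ st.h K)) := by
    funext K
    exact ((h1 s K i₁ (S.cechδ st.h K) (st.pure_cechδ' e K) (st.d_dbar_cechδ' e K)).choose_spec.2).symm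
  rw [heq, cechδ_dbar, S.cechδ_cechδ, map_zero, map_zero]

/-- **The zig-zag step.** From a stage `(i, h_s)` on the `(s+1)`-tuples to a stage on the
`(s+2)`-tuples: `∂̄ (δ h_s)` is `d`-closed (its `∂` is `δ ∂∂̄ h_s = 0` by the invariant, its `∂̄`
vanishes) and `∂̄`-exact of pure type `(i, b'+1)`, hence by the `∂∂̄`-lemma of the strata it is
`∂∂̄ h_{s+1}` with `h_{s+1}` of type `(i-1, b')` — or `0` when `i = 0`, where the recursion stops
with `h_{s+1} = 0`. [cite: DeligneGriffithsMorganSullivan1975, §5] -/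
private def step (h1 : DDbarSuccHyp) {s : ℕ} (st : Stage (S := S) (b' := b') s) :
    Stage (S := S) (b' := b') (s + 1) :=
  if hi : st.i = 0 then
    ⟨0, fun _ ↦ 0, fun _ ↦ by rw [map_zero], fun K ↦ by simp only [map_zero]; exact S.cechδ_zero K⟩
  else
    have e : st.i = st.i - 1 + 1 := by omega
    ⟨st.i - 1,
      fun K ↦ (h1 s K (st.i - 1) (S.cechδ st.h K) (st.pure_cechδ' e K) (st.d_dbar_cechδ' e K)).choose,
      fun K ↦ (h1 s K (st.i - 1) (S.cechδ st.h K) (st.pure_cechδ' e K)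
        (st.d_dbar_cechδ' e K)).choose_spec.1,
      step_inv h1 st e⟩

/-- **The zig-zag equation of one step**: `δ (∂̄ h_s) = ∂̄ (δ h_s) = d (∂̄ h_{s+1})`
(`= ∂∂̄ h_{s+1}`; in the terminal case `i = 0` both sides vanish, the left one by the
`∂∂̄`-lemma). [cite: DeligneGriffithsMorganSullivan1975, §5] -/
private theorem step_eq (h0 : DDbarZeroHyp) (h1 : DDbarSuccHyp) {s : ℕ}
    (st : Stage (S := S) (b' := b') s) (K : Fin (s + 2) → ι) :
    S.π K st.i (b' + 1) (S.d K (S.cechδ st.h K)) =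
      S.d K (S.π K (step h1 st).i (b' + 1) (S.d K ((step h1 st).h K))) := by
  unfold step
  by_cases hi : st.i = 0
  · rw [dif_pos hi]
    show S.π K st.i (b' + 1) (S.d K (S.cechδ st.h K)) = S.d K (S.π K 0 (b' + 1) (S.d K 0))
    rw [map_zero, map_zero, map_zero]
    have hp := st.pure_cechδ K
    have hc := st.d_dbar_cechδ K
    rw [hi] at hp hc ⊢
    exact h0 s K _ hp hc
  · rw [dif_neg hi]
    have e : st.i = st.i - 1 + 1 := by omega
    show S.π K st.i (b' + 1) (S.d K (S.cechδ st.h K)) = S.d K (S.π K (st.i - 1) (b' + 1) (S.d K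
      (h1 s K (st.i - 1) (S.cechδ st.h K) (st.pure_cechδ' e K) (st.d_dbar_cechδ' e K)).choose))
    have h2 := (h1 s K (st.i - 1) (S.cechδ st.h K) (st.pure_cechδ' e K)
      (st.d_dbar_cechδ' e K)).choose_spec
    calc S.π K st.i (b' + 1) (S.d K (S.cechδ st.h K))
        = S.π K (st.i - 1 + 1) (b' + 1) (S.d K (S.cechδ st.h K)) := by rw [← e]
      _ = _ := h2.2
      _ = _ := (S.d_dbar K (st.i - 1) b' _ h2.1).symm

/-- The stages of the zig-zag, by recursion from `h_0 = g`. [cite: DeligneGriffithsMorganSullivan1975, §5] -/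
private def stage (h1 : DDbarSuccHyp) {a' : ℕ}
    (g : ∀ J : Fin 1 → ι, S.T J) (hg : ∀ J, S.π J a' b' (g J) = g J)
    (hginv : ∀ K : Fin 2 → ι,
      S.cechδ (fun J ↦ S.π J (a' + 1) (b' + 1) (S.d J (S.π J a' (b' + 1) (S.d J (g J))))) K = 0) :
    ∀ s : ℕ, Stage (S := S) (b' := b') s
  | 0 => ⟨a', g, hg, hginv⟩
  | s + 1 => step h1 (stage h1 g hg hginv s)

/-- The first type index decreases by one at each stage (truncated at `0`). [folklore] -/
private theorem stage_i (h1 : DDbarSuccHyp) {a' : ℕ}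
    (g : ∀ J : Fin 1 → ι, S.T J) (hg : ∀ J, S.π J a' b' (g J) = g J)
    (hginv : ∀ K : Fin 2 → ι,
      S.cechδ (fun J ↦ S.π J (a' + 1) (b' + 1) (S.d J (S.π J a' (b' + 1) (S.d J (g J))))) K = 0)
    (s : ℕ) : (stage h1 g hg hginv s).i = a' - s := by
  induction s with
  | zero => rfl
  | succ s ih =>
    change (step h1 (stage h1 g hg hginv s)).i = a' - (s + 1)
    unfold step
    by_cases hi : (stage h1 g hg hginv s).i = 0
    · rw [dif_pos hi]
      show (0 : ℕ) = a' - (s + 1)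
      omega
    · rw [dif_neg hi]
      show (stage h1 g hg hginv s).i - 1 = a' - (s + 1)
      omega

/-- Past the first type index `0` the potentials vanish. [folklore] -/
private theorem stage_h_eq_zero (h1 : DDbarSuccHyp) {a' : ℕ}
    (g : ∀ J : Fin 1 → ι, S.T J) (hg : ∀ J, S.π J a' b' (g J) = g J)
    (hginv : ∀ K : Fin 2 → ι,
      S.cechδ (fun J ↦ S.π J (a' + 1) (b' + 1) (S.d J (S.π J a' (b' + 1) (S.d J (g J))))) K = 0)
    {s : ℕ} (hs : a' < s) (J : Fin (s + 1) → ι) : (stage h1 g hg hginv s).h J = 0 := by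
  obtain ⟨t, rfl⟩ : ∃ t, s = t + 1 := Nat.exists_eq_succ_of_ne_zero (by omega)
  have hi : (stage h1 g hg hginv t).i = 0 := by rw [stage_i]; omega
  change (step h1 (stage h1 g hg hginv t)).h J = 0
  unfold step
  rw [dif_pos hi]

/-- **The zig-zag equation at a stage**: `δ (∂̄ h_s) = d (∂̄ h_{s+1})`. [cite: DeligneGriffithsMorganSullivan1975, §5] -/
private theorem stage_eq (h0 : DDbarZeroHyp) (h1 : DDbarSuccHyp) {a' : ℕ}
    (g : ∀ J : Fin 1 → ι, S.T J) (hg : ∀ J, S.π J a' b' (g J) = g J)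
    (hginv : ∀ K : Fin 2 → ι,
      S.cechδ (fun J ↦ S.π J (a' + 1) (b' + 1) (S.d J (S.π J a' (b' + 1) (S.d J (g J))))) K = 0)
    (s : ℕ) (K : Fin (s + 2) → ι) :
    S.cechδ (fun J ↦ S.π J (stage h1 g hg hginv s).i (b' + 1)
        (S.d J ((stage h1 g hg hginv s).h J))) K =
      S.d K (S.π K (stage h1 g hg hginv (s + 1)).i (b' + 1)
        (S.d K ((stage h1 g hg hginv (s + 1)).h K))) := by
  rw [cechδ_dbar]
  exact step_eq h0 h1 (stage h1 g hg hginv s) K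

/-- **The `∂∂̄` zig-zag in the Čech complex** (Griffiths–Schmid 1975 §4, "principle of two types";
DGMS 1975 §5–6). Let `S` be a `∂∂̄`-Čech system whose strata of length `≥ 2` satisfy the
`∂∂̄`-lemma for `d`-closed `∂̄`-exact elements of type `(·, b'+1)` (`DDbarZeroHyp`,
`DDbarSuccHyp`). Let `x_J` (`J` of length `1`, `2`) be compatible with restriction and of the form
`x_J = ∂∂̄ g_J` on the strata of length `1`, with `g_J` pure of type `(a', b')`. Then there are
Čech cochains `η_s ∈ Π_{|J| = s+1} T_J`, `s ≥ 0`, with `d η_0 = x`, `δ η_s = d η_{s+1}` for all `s`,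
`η_s` pure of type `(a' - s, b' + 1)` and `η_s = 0` for `s > a'` — i.e. `(x_J)_J = D η` in the
total complex of the Čech–de Rham double complex. [cite: DeligneGriffithsMorganSullivan1975, §5]
[cite: DeligneGriffithsMorganSullivan1975, §5 Lemma 5.11 and §6] [cite: DeligneHodgeIII1974, Prop. 8.2.7] -/
theorem exists_zigzag (h0 : DDbarZeroHyp) (h1 : DDbarSuccHyp) {a' : ℕ}
    (x : ∀ ⦃p : ℕ⦄ (J : Fin p → ι), S.T J)
    (hx : ∀ (K : Fin 2 → ι) (j : Fin 2), S.res K (Fin.succAbove j) (x (K ∘ Fin.succAbove j)) = x K)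
    (g : ∀ J : Fin 1 → ι, S.T J) (hg : ∀ J, S.π J a' b' (g J) = g J)
    (hgx : ∀ J : Fin 1 → ι, x J = S.π J (a' + 1) (b' + 1) (S.d J (S.π J a' (b' + 1) (S.d J (g J))))) :
    ∃ η : ∀ s : ℕ, ∀ J : Fin (s + 1) → ι, S.T J,
      (∀ J : Fin 1 → ι, S.d J (η 0 J) = x J) ∧
      (∀ (s : ℕ) (K : Fin (s + 2) → ι), S.cechδ (η s) K = S.d K (η (s + 1) K)) ∧
      (∀ (s : ℕ) (J : Fin (s + 1) → ι), S.π J (a' - s) (b' + 1) (η s J) = η s J) ∧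
      (∀ (s : ℕ) (J : Fin (s + 1) → ι), a' < s → η s J = 0) := by
  -- `δ (∂∂̄ g) = δ x = 0`
  have hginv : ∀ K : Fin 2 → ι,
      S.cechδ (fun J ↦ S.π J (a' + 1) (b' + 1) (S.d J (S.π J a' (b' + 1) (S.d J (g J))))) K = 0 := by
    intro K
    have h := S.cechδ_eq_zero_of_res_eq x hx K
    have e : (fun J : Fin 1 → ι ↦ x J) =
        fun J ↦ S.π J (a' + 1) (b' + 1) (S.d J (S.π J a' (b' + 1) (S.d J (g J)))) := funext hgx
    rwa [e] at h
  refine ⟨fun s J ↦ S.π J (stage h1 g hg hginv s).i (b' + 1) (S.d J ((stage h1 g hg hginv s).h J)),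
    fun J ↦ ?_, fun s K ↦ stage_eq h0 h1 g hg hginv s K, fun s J ↦ ?_, fun s J hs ↦ ?_⟩
  · -- `d η_0 = d ∂̄ g = ∂∂̄ g = x`
    change S.d J (S.π J a' (b' + 1) (S.d J (g J))) = x J
    rw [S.d_dbar J a' b' _ (hg J), hgx J]
  · show S.π J (a' - s) (b' + 1) (S.π J (stage h1 g hg hginv s).i (b' + 1)
        (S.d J ((stage h1 g hg hginv s).h J))) =
      S.π J (stage h1 g hg hginv s).i (b' + 1) (S.d J ((stage h1 g hg hginv s).h J))
    rw [stage_i h1 g hg hginv s, S.π_π]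
  · show S.π J (stage h1 g hg hginv s).i (b' + 1) (S.d J ((stage h1 g hg hginv s).h J)) = 0
    rw [stage_h_eq_zero h1 g hg hginv hs J, map_zero, map_zero]

end Zigzag

end DDbarCechSystem

end Literature.Algebra.Homology

end
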